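import Literature.MathematicalPhysics.QuantumFieldTheory.Balaban1983to89.B11LeafKnit
import Literature.MathematicalPhysics.QuantumFieldTheory.Balaban1983to89.B11Prop6Concrete

/-!
# `Balaban1983to89.B11LeafKnitSectE` — T. Bałaban, *The variational problem and background fields in renormalization group method for
# lattice gauge theories*, Commun. Math. Phys. **102** (1985) 277–309 [Balaban1985Variational]: **the B11 leaf and the DAG node N07 at a
# carrier bundle whose Sect. A–E family IS a Sect. E family AT OBJECTS** — the leaf conjuncts p6 (Proposition 6, pp. 295–296) and p4
# (Proposition 4, pp. 292–293) are then THEOREMS (`B11Prop6Concrete.prop6Printed_concrete` ∕ `prop4Printed_concrete`, BY NAME), so N07's knit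
# needs two printed parts fewer

statement-level bookkeeping over published theorems with citation tags; proofs = kernel composition of landed modules BY NAME; nothing here
is a claim about the Yang–Mills mass gap

PDF held: `paper:balaban1985-cmp102-variational-background` (journal page = PDF page + 276).

CITATION HEADER (lean-in-tree rule 2026-08-18) ∕ WHAT IS REPRODUCED.  Cell `pub-ymgap`, Track A node N07 = [B11] (`Dag.B11_main` = «b5 → b6 →
b7 → b8 → b9 → b11», own leaf `DagBinding.B11Leaf Z`); prover seat `pub-ymgap-dag-n16-d` (R134 acceleration seat of node N16, strategy s3,
director-ym row «R1^ϱ = [B11] Prop 6 p.295 CONCRETE (`prop6Printed_concrete`; ONE proof shared with N07 — files `--supports` both)»): THIS is the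
N07 side of the share (the N16 side is `Summits/QuantumFields/YangMills/Theorems/BalabanUVNodesN16R1RhoConcrete.lean`, p453611).  The ONE proof is
n07-b's `B11Prop6Concrete` (p422035): for EVERY family of Sect. E data at objects `D i : SectEDatum …` with remaining fields `R i`, the typed
statement of record `B11.Prop6Printed B₀ B₃ C₁ (fun i ↦ (D i).toLGData (R i) C₁)` holds (`prop6Printed_concrete`), and so does
`B11.Prop4Printed C₁ B₃ (…)` (`prop4Printed_concrete`, the datum's Prop-4 slot read as the typed Proposition 4).  Every N07 knit in the tree
(`B11LeafKnit.b11Leaf_of_parts` ∕ `b11_main_of_parts`, `B11LeafKnitFull`, `B11LeafKnitB8Edge`, `B11LeafKnitTower`, `B11LeafKnitProp9`,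
`B11LeafKnitTwoTier(Full)`) carries `(p4 : Prop4Printed …) (p6 : Prop6Printed …)` as BINDERS on an arbitrary `Z.famLG`; here `Z.famLG` is a Sect. E
family at objects and the two binders are supplied.  A NEW LEAF over `B11LeafKnit` (seat dag-n07-a) and `B11Prop6Concrete` (seat dag-n07-b);
nothing there is modified; NO definition (theorems only).
§1 `prop6_conjunct_of_sectE`, `prop4_conjunct_of_sectE`: at a bundle `Z : DagBinding.PrintedCarriers11` with
   `Z.famLG = fun i ↦ (D i).toLGData (R i) Z.C₁` (`D i : B11Prop6Concrete.SectEDatum d (Pd i) 𝔸 L (η i) (β i) Z.B₀ C₄ a₃ Z.B₃ α`), the leaf conjuncts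
   `B11.Prop6Printed Z.B₀ Z.B₃ Z.C₁ Z.famLG` and `B11.Prop4Printed Z.C₁ Z.B₃ Z.famLG` HOLD.
§2 `prop7_conjunct_of_parts_sectE`: Proposition 7 inside the leaf from Props 2, 5 ONLY (+ the bridge laws, the capped existence leaves and the
   Sect. A law below a threshold, as in `B11LeafKnit.prop7_conjunct_of_parts_small`) — p6 discharged.
§3 `b11Leaf_of_parts_sectE`: `DagBinding.B11Leaf Z` from SIX printed parts (Props 2, 3, 5, 8, Sect. F, Prop 9) + the same dictionary — p4, p6
   discharged; `b11_main_of_parts_sectE`: the node `Dag.B11_main (leavesP w P)` at a run with `w.up P = Upstream.ofPrintedAllXPN X Y Z V W`, likewise.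
HONEST SCOPE.  (i) Bookkeeping by name: the in-edge letters [Balaban1985BackgroundPropagators] Thms 3.12∕3.13 (‖𝔊(U₀)‖, ‖H₁(U₀)‖ ≤ B₀) and
Proposition 4's (98) with its analyticity are the Sect. E datum's displayed FIELDS `norm_G` ∕ `norm_H₁` ∕ `prop4` (N06 content ∕ the leaf's
own p4 at letters: `B11Eq98CurrentSlot.prop4Hyp_W80`, `B11Ineq73KernelLettersPerLattice`) — «p4 discharged» means «read off the datum field»,
exactly as `prop4Printed_concrete` says; «p6 discharged» is the printed Sect. E contraction proved in kernel (`B11Prop6Scheme`,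
`B11Eq174Chart`, `B11Prop6Model`, `B11Prop6Concrete`).  (ii) Props 2, 3, 5, 8, Sect. F, Prop 9 and the located leaves remain INPUTS.  (iii) The
uniformity of B₀, C₄, a₃ across the family is asked by the datum type (constants fixed before the index).  Count-neutral Track-A bookkeeping;
NOT a discharge of N07 (the B11 group is pinned by NODE 00, `Node00/CarriersZ.lean`, whose `famLG` the Sect. E slice extends — n07-b's
trigger t2); one finite T⁴ programme at fixed ε; Bałaban AS PRINTED with locators; nothing continuum ∕ ℝ⁴ ∕ OS ∕ mass-gap ∕ Clay.
Filed `--supports stmt-QuantumFields-19674` (K1 `StabilityBAtRecordR11e`).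
-/

namespace Literature.MathematicalPhysics.QuantumFieldTheory.Balaban1983to89.B11LeafKnitSectE

open Literature.MathematicalPhysics.QuantumFieldTheory.Balaban1983to89
open Literature.MathematicalPhysics.QuantumFieldTheory.Balaban1983to89.B11
open Literature.MathematicalPhysics.QuantumFieldTheory.Balaban1983to89.DagBinding
open Literature.MathematicalPhysics.QuantumFieldTheory.Balaban1983to89.B11Prop7Assembly (Bridge ExistenceLeavesCap)
open Literature.MathematicalPhysics.QuantumFieldTheory.Balaban1983to89.B11Prop6Concrete (SectEDatum Rest prop6Printed_concrete
  prop4Printed_concrete)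

noncomputable section

variable (Z : PrintedCarriers11)
variable {𝔸 : Type} [NormedRing 𝔸] [NormedAlgebra ℂ 𝔸] [StarRing 𝔸] [FiniteDimensional ℂ 𝔸] [NormedStarGroup 𝔸] [StarModule ℂ 𝔸]
variable {d : ℕ} {Pd : Z.I11 → Fin d → ℕ} {L : ℝ} [Fact (0 < L)] {η : Z.I11 → ℝ} [∀ i, Fact (0 < η i)] {β : Z.I11 → Type}
  [∀ i, Fintype (β i)] {C₄ a₃ α : ℝ}

/-! ## §1. The leaf conjuncts p6 and p4 at a bundle whose Sect. A–E family is a Sect. E family at objects -/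

/-- **THE LEAF CONJUNCT p6 IS A THEOREM WHEN `Z.famLG` IS A Sect. E FAMILY AT OBJECTS** (Proposition 6, pp. 295–296: *«There exists a positive,
absolute constant a₄ such, that for ε₄ ≤ a₄ and ε₁ satisfying 2B₀C₁B₃ε₁ ≤ ε₄ Eq. (111) has exactly one solution in the space (115). This solution
satisfies the bounds (115) with ε₄ = 3B₀C₁B₃ε₁ …»*): for a B11 carrier bundle `Z` whose Sect. A–E family is `fun i ↦ (D i).toLGData (R i) Z.C₁`
(`D i` a Sect. E datum at objects over the lattice `Pd i` at spacing `η i` with the bundle's constants `Z.B₀`, `Z.B₃` and Prop-4 letters `C₄, a₃`,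
admissibility threshold `α`; all positive, `Z.C₁ > 0`), `B11.Prop6Printed Z.B₀ Z.B₃ Z.C₁ Z.famLG` — `B11Prop6Concrete.prop6Printed_concrete` BY NAME.
[cite: Balaban1985Variational, Prop. 6 pp.295–296] -/
theorem prop6_conjunct_of_sectE (D : ∀ i, SectEDatum d (Pd i) 𝔸 L (η i) (β i) Z.B₀ C₄ a₃ Z.B₃ α) (R : ∀ i, Rest (D i))
    (hZ : Z.famLG = fun i => (D i).toLGData (R i) Z.C₁)
    (hB₀ : 0 < Z.B₀) (hC₄ : 0 < C₄) (ha₃ : 0 < a₃) (hB₃ : 0 < Z.B₃) (hα : 0 < α) (hC₁ : 0 < Z.C₁) :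
    Prop6Printed Z.B₀ Z.B₃ Z.C₁ Z.famLG := by
  rw [hZ]
  exact prop6Printed_concrete hB₀ hC₄ ha₃ hB₃ hα hC₁ D R

omit [FiniteDimensional ℂ 𝔸] [NormedStarGroup 𝔸] [StarModule ℂ 𝔸] in
/-- **THE LEAF CONJUNCT p4 IS A THEOREM WHEN `Z.famLG` IS A Sect. E FAMILY AT OBJECTS** (Proposition 4 (97)–(98), pp. 292–293: on such a family the
typed Proposition 4 is the datum's Prop-4 slot, `B11Prop6Concrete.prop4Printed_concrete` BY NAME — constants (a₃∕2, C₄), threshold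
`ε₁ ≤ α∕(C₁B₃)`). [cite: Balaban1985Variational, Prop. 4 pp.292–293] -/
theorem prop4_conjunct_of_sectE (D : ∀ i, SectEDatum d (Pd i) 𝔸 L (η i) (β i) Z.B₀ C₄ a₃ Z.B₃ α) (R : ∀ i, Rest (D i))
    (hZ : Z.famLG = fun i => (D i).toLGData (R i) Z.C₁)
    (hC₄ : 0 < C₄) (ha₃ : 0 < a₃) (hB₃ : 0 < Z.B₃) (hα : 0 < α) (hC₁ : 0 < Z.C₁) :
    Prop4Printed Z.C₁ Z.B₃ Z.famLG := by
  rw [hZ]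
  exact prop4Printed_concrete hC₄ ha₃ hB₃ hα hC₁ D R

/-! ## §2. Proposition 7 inside the leaf from Props 2, 5 — p6 discharged -/

/-- **PROPOSITION 7 INSIDE THE LEAF FROM PROPS 2 AND 5 ONLY, AT A Sect. E BUNDLE** (p. 296: *«… then by Propositions 5 and 6 there is at most one
critical configuration of (5) in (19)–(21) …»*; p. 299 Prop. 7): `B11LeafKnit.prop7_conjunct_of_parts_small` (bridge laws (15)–(18), capped
existence leaves of pp. 296–299∕301, the Sect. A law (12)–(14) below a threshold `a`, the printed relations B₀ ≤ 4B₁, B₃ ≥ 1, C₁ ≥ 1) with its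
binder p6 SUPPLIED by `prop6_conjunct_of_sectE`. [cite: Balaban1985Variational, Prop. 7 p.299; (122) p.296; (12)–(18) p.280] -/
theorem prop7_conjunct_of_parts_sectE (D : ∀ i, SectEDatum d (Pd i) 𝔸 L (η i) (β i) Z.B₀ C₄ a₃ Z.B₃ α) (R : ∀ i, Rest (D i))
    (hZ : Z.famLG = fun i => (D i).toLGData (R i) Z.C₁) (hC₄ : 0 < C₄) (ha₃ : 0 < a₃) (hα : 0 < α)
    (βr : ∀ i, Bridge (Z.famX i) (Z.famLG i)) {O₁ O₂ e₅ a : ℝ}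
    (laws : ∀ i, (βr i).Laws Z.C₁ Z.B₃) (leaves : ∀ i, ExistenceLeavesCap (βr i) Z.B₀ Z.B₃ Z.C₁ O₁ O₂ e₅)
    (hB₀ : 0 < Z.B₀) (hB₁ : 0 < Z.B₁) (hB₃ : 1 ≤ Z.B₃) (hC₁ : 1 ≤ Z.C₁) (hB₀B₁ : Z.B₀ ≤ 4 * Z.B₁) (hc₁ : 0 < Z.c₁)
    (hO₁ : 0 < O₁) (hO₂ : 0 < O₂) (he₅ : 0 < e₅) (ha : 0 < a)
    (hbg : ∀ (i : Z.I11) (ε₁ : ℝ) (V : (Z.famX i).Bdry), 0 < ε₁ → ε₁ ≤ a → (Z.famX i).Reg7 ε₁ V →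
      ∃ U₀ : (Z.famLG i).Cfg, (Z.famLG i).Sat14 (Z.C₁ * Z.B₃ * ε₁) (Z.C₁ * ε₁) ((βr i).bdry V) U₀)
    (p2 : Prop2Printed Z.B₁ Z.B₃ Z.C₁ Z.c₁ Z.famLG) (p5 : Prop5Printed Z.B₁ Z.B₃ Z.C₁ Z.famLG) :
    Prop7Printed Z.B₃ Z.C₁ Z.famX :=
  B11LeafKnit.prop7_conjunct_of_parts_small Z βr laws leaves hB₀ hB₁ hB₃ hC₁ hB₀B₁ hc₁ hO₁ hO₂ he₅ ha hbg p2 p5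
    (prop6_conjunct_of_sectE Z D R hZ hB₀ hC₄ ha₃ (lt_of_lt_of_le one_pos hB₃) hα (lt_of_lt_of_le one_pos hC₁))

/-! ## §3. The leaf and the node from six printed parts — p4, p6 discharged -/

/-- **THE B11 LEAF AT A Sect. E BUNDLE FROM SIX PRINTED PARTS** (Props 2, 3, 5, 8, Sect. F, Prop 9) plus the dictionary `B11LeafKnit.b11Leaf_of_parts`
consumes (bridge laws, capped existence leaves, Theorem-1 carrier laws, the Sect. A law below `a`, `Z.famV = (Z.famX ·).toVarProblem`, the
printed relations among the constants): the binders p4 and p6 of that knit are SUPPLIED by §1.  Nothing of the series is asserted; Props 2, 3, 5,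
8, Sect. F, Prop 9 remain inputs. [cite: Balaban1985Variational, Thm 1 p.279, Props 2–9 pp.281–309] -/
theorem b11Leaf_of_parts_sectE (D : ∀ i, SectEDatum d (Pd i) 𝔸 L (η i) (β i) Z.B₀ C₄ a₃ Z.B₃ α) (R : ∀ i, Rest (D i))
    (hZ : Z.famLG = fun i => (D i).toLGData (R i) Z.C₁) (hC₄ : 0 < C₄) (ha₃ : 0 < a₃) (hα : 0 < α)
    (βr : ∀ i, Bridge (Z.famX i) (Z.famLG i)) {O₁ O₂ e₅ a : ℝ}
    (laws : ∀ i, (βr i).Laws Z.C₁ Z.B₃) (leaves : ∀ i, ExistenceLeavesCap (βr i) Z.B₀ Z.B₃ Z.C₁ O₁ O₂ e₅)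
    (plaws : ∀ i, (Z.famX i).Laws)
    (hB₀ : 0 < Z.B₀) (hB₁ : 0 < Z.B₁) (hB₃ : 1 ≤ Z.B₃) (hC₁ : 1 ≤ Z.C₁) (hB₀B₁ : Z.B₀ ≤ 4 * Z.B₁) (hc₁ : 0 < Z.c₁)
    (hO₁ : 0 < O₁) (hO₂ : 0 < O₂) (he₅ : 0 < e₅) (ha : 0 < a)
    (hbg : ∀ (i : Z.I11) (ε₁ : ℝ) (V : (Z.famX i).Bdry), 0 < ε₁ → ε₁ ≤ a → (Z.famX i).Reg7 ε₁ V →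
      ∃ U₀ : (Z.famLG i).Cfg, (Z.famLG i).Sat14 (Z.C₁ * Z.B₃ * ε₁) (Z.C₁ * ε₁) ((βr i).bdry V) U₀)
    (hV : Z.famV = fun i => (Z.famX i).toVarProblem)
    (p2 : Prop2Printed Z.B₁ Z.B₃ Z.C₁ Z.c₁ Z.famLG) (p3 : Prop3Printed Z.C₁ Z.B₃ Z.C₂ Z.C₃ Z.B₀ Z.c1h Z.c₄ Z.δ₀ Z.famLG)
    (p5 : Prop5Printed Z.B₁ Z.B₃ Z.C₁ Z.famLG)
    (p8 : Prop8Printed Z.B₃ Z.famX) (sF : SectFPrinted Z.B₃ Z.famX) (p9 : Prop9Printed Z.B₅ Z.C₁ Z.β₀ Z.δ₀ Z.famAn) :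
    B11Leaf Z :=
  have hB₃pos : 0 < Z.B₃ := lt_of_lt_of_le one_pos hB₃
  have hC₁pos : 0 < Z.C₁ := lt_of_lt_of_le one_pos hC₁
  B11LeafKnit.b11Leaf_of_parts Z βr laws leaves plaws hB₀ hB₁ hB₃ hC₁ hB₀B₁ hc₁ hO₁ hO₂ he₅ ha hbg hV p2 p3
    (prop4_conjunct_of_sectE Z D R hZ hC₄ ha₃ hB₃pos hα hC₁pos) p5
    (prop6_conjunct_of_sectE Z D R hZ hB₀ hC₄ ha₃ hB₃pos hα hC₁pos) p8 sF p9

/-- **THE NODE N07 AT A BINDING OF RECORD WHOSE B11 GROUP IS A Sect. E BUNDLE, FROM SIX PRINTED PARTS**: for every binding world and run with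
`w.up P = Upstream.ofPrintedAllXPN X Y Z V W`, the inputs of `b11Leaf_of_parts_sectE` at the run's B11 group `Z` give `Dag.B11_main (leavesP w P)`
(`B11LeafKnit.b11_main_of_leaf`).  THE HYPOTHESIS LIST IS N07's PIN LIST TWO ITEMS SHORTER whenever NODE 00 pins the B11 group's Sect. A–E family as
a Sect. E family at objects; nothing is discharged here. [cite: Balaban1985Variational, Thm 1 p.279, Props 2–9 pp.281–309] -/
theorem b11_main_of_parts_sectE (w : WorldP) (P : B12.RunParams) (X : PrintedCarriersR) (Y : PrintedCarriers9X)
    (V : PrintedCarriers14R) (W : PrintedCarriers15) (hP : w.up P = Upstream.ofPrintedAllXPN X Y Z V W)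
    (D : ∀ i, SectEDatum d (Pd i) 𝔸 L (η i) (β i) Z.B₀ C₄ a₃ Z.B₃ α) (R : ∀ i, Rest (D i))
    (hZ : Z.famLG = fun i => (D i).toLGData (R i) Z.C₁) (hC₄ : 0 < C₄) (ha₃ : 0 < a₃) (hα : 0 < α)
    (βr : ∀ i, Bridge (Z.famX i) (Z.famLG i)) {O₁ O₂ e₅ a : ℝ}
    (laws : ∀ i, (βr i).Laws Z.C₁ Z.B₃) (leaves : ∀ i, ExistenceLeavesCap (βr i) Z.B₀ Z.B₃ Z.C₁ O₁ O₂ e₅)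
    (plaws : ∀ i, (Z.famX i).Laws)
    (hB₀ : 0 < Z.B₀) (hB₁ : 0 < Z.B₁) (hB₃ : 1 ≤ Z.B₃) (hC₁ : 1 ≤ Z.C₁) (hB₀B₁ : Z.B₀ ≤ 4 * Z.B₁) (hc₁ : 0 < Z.c₁)
    (hO₁ : 0 < O₁) (hO₂ : 0 < O₂) (he₅ : 0 < e₅) (ha : 0 < a)
    (hbg : ∀ (i : Z.I11) (ε₁ : ℝ) (V : (Z.famX i).Bdry), 0 < ε₁ → ε₁ ≤ a → (Z.famX i).Reg7 ε₁ V →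
      ∃ U₀ : (Z.famLG i).Cfg, (Z.famLG i).Sat14 (Z.C₁ * Z.B₃ * ε₁) (Z.C₁ * ε₁) ((βr i).bdry V) U₀)
    (hV : Z.famV = fun i => (Z.famX i).toVarProblem)
    (p2 : Prop2Printed Z.B₁ Z.B₃ Z.C₁ Z.c₁ Z.famLG) (p3 : Prop3Printed Z.C₁ Z.B₃ Z.C₂ Z.C₃ Z.B₀ Z.c1h Z.c₄ Z.δ₀ Z.famLG)
    (p5 : Prop5Printed Z.B₁ Z.B₃ Z.C₁ Z.famLG)
    (p8 : Prop8Printed Z.B₃ Z.famX) (sF : SectFPrinted Z.B₃ Z.famX) (p9 : Prop9Printed Z.B₅ Z.C₁ Z.β₀ Z.δ₀ Z.famAn) :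
    Dag.B11_main (leavesP w P) :=
  B11LeafKnit.b11_main_of_leaf w P X Y Z V W hP
    (b11Leaf_of_parts_sectE Z D R hZ hC₄ ha₃ hα βr laws leaves plaws hB₀ hB₁ hB₃ hC₁ hB₀B₁ hc₁ hO₁ hO₂ he₅ ha hbg hV p2 p3 p5
      p8 sF p9)

end

end Literature.MathematicalPhysics.QuantumFieldTheory.Balaban1983to89.B11LeafKnitSectE
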